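import Summits.BirchSwinnertonDyer.BirchSwinnertonDyer.Theorems.EisensteinPrimesStrictEqUnramifiedCentral
import Summits.BirchSwinnertonDyer.BirchSwinnertonDyer.Theorems.EisensteinPrimesCharGrSelmerLambdaRelaxation
import Literature.NumberTheory.GaloisRepresentations.LocalGaloisGroupHenselProofs
import Literature.NumberTheory.GaloisRepresentations.LocalGaloisGroupProofs
import Mathlib.FieldTheory.Finite.GaloisField
import HarnessLib

/-!
# `[D_v, D_v] ⊆ I_v` (the Frobenius quotient of a local Galois group is abelian), and the STRICT = UNRAMIFIED bridge at `v̄`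
# for both residual characters of a NON-SPLIT multiplicative Eisenstein prime, UNCONDITIONALLY
# (cell `bsd-eis`, width seat `bsd-line-x2-p2` gen 8; crux 4 `BSDpOnCellC` stmt-BirchSwinnertonDyer-19034, line b1 v12 UNCHANGED)

WHY. This seat's `…StrictEqUnramifiedCentral` (p660721) proves `grSelmer κ (charModule ∅ θ) v̄ S₀ = unrSelmer κ (charModule ∅ θ) v̄ S₀`
for a Teichmüller character non-trivial on `D_v̄`, GRANTED `hDI : ∀ x y ∈ D_v̄, x⁻¹y⁻¹xy ∈ I_v̄`. This file DISCHARGES `hDI`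
(Serre, *Corps locaux* I §7–§8: `D/I ≅ Gal(k̄_𝔓/k)` is procyclic, generated by Frobenius — hence abelian) from Mathlib's
`Ideal.Quotient.stabilizerHom` / `ker_stabilizerHom` (the decomposition group acts on the residue extension with kernel the inertia
group) and the commutativity of the `k`-automorphisms of an algebraic extension of a FINITE field `k` (every finite subextension
`k(x)` is Galois with cyclic group generated by Frobenius — Mathlib's `bijective_frobeniusAlgEquivOfAlgebraic_pow`), through the
tree's local absolute Galois library (`absInertia F = 𝔓.inertia Γ_F`, `smul_absMaximalIdeal_holds`, `absMaximalIdeal_isMaximal_holds`,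
`under_absMaximalIdeal_holds`) and the chosen embedding (`GreenbergSelmer.decomp v` / `inertia v` are the images of `Γ_{K_v}` / `I_{K_v}`).
Then the bridge is UNCONDITIONAL: for every residual character `θ ∈ {θsub, θquot}` of `E_K[p]` at a NON-SPLIT multiplicative
Eisenstein datum, the STRICT (CGLS `𝓕_Gr`, Castella) and UNRAMIFIED (Keller–Yin `𝓕_nr`, Rubin / the x1 cell's [BR] programme) Selmer
groups over `K_∞` COINCIDE, for every `S₀` — so crux 4's [ALG-imp] + [PWL-θ] chain (p654300, p658583, p659748) reads verbatim on the
duals that the x1 cell's `CharMainConjOnTree` / `charMainConj_conclusion_of_rubin` speak about.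

WHAT.
* §1 `algEquiv_mul_comm_of_finite_of_isAlgebraic` — `k` finite, `L/k` algebraic: any two `k`-algebra automorphisms of `L` commute.
* §2 `commutator_mem_absInertia` — `F` a non-archimedean local field: `σ⁻¹τ⁻¹στ ∈ I_F` for all `σ, τ ∈ Γ_F`.
* §3 `commutator_mem_inertia` — `K` a number field, `v` a finite place: `x⁻¹y⁻¹xy ∈ inertia v` for `x, y ∈ decomp v`.
* §4 `grSelmer_charModule_eq_unrSelmer` — `(hDI)`-free forms of p660721's bridge: for `θ^{p−1} = 1` with `D_v̄` not fixing
  `(F/𝒪)(θ)[p]` pointwise, `grSelmer κ (charModule ∅ θ) v̄ S₀ = unrSelmer κ (charModule ∅ θ) v̄ S₀` (any number field, any `κ`, any `S₀`);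
  `grSelmer_eq_unrSelmer_of_not_split` — at a NON-SPLIT multiplicative Eisenstein datum, for both residual characters.

HONEST FRAMING: tool theorems only (no definition, no named fact, no `sorry`, no `Theses` import); §1–§4 UNCONDITIONAL; nothing about
any curve's BSD / MC / IMC is asserted; closes no stub of v12.

References: [SerreLocalFields1979] Ch. I §7 Prop. 20–21, §8 (D/I and the residue extension); [CastellaGrossiLeeSkinner2022] proof of
Thm. 1.2.2 with Prop. 1.1.2 (i); [KellerYin2024] Rem. 1.2.3, Lemma 1.2.4; [NeukirchANT1999] Ch. II §9 (9.6).
-/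

set_option autoImplicit false
set_option linter.dupNamespace false -- the summit namespace `…BirchSwinnertonDyer.BirchSwinnertonDyer.Theorems` (Sub = Summit, D-0017) trips it

noncomputable section

open scoped Classical Pointwise

namespace Summit.BirchSwinnertonDyer.BirchSwinnertonDyer.Theorems.StrictEqUnramifiedCentral

/-! ### §1 `k`-automorphisms of an algebraic extension of a finite field commute -/

section FiniteField

open IntermediateField

/-- **Any two `k`-algebra automorphisms of an algebraic extension `L` of a FINITE field `k` commute**: on the finite Galois
subextension `k⟮x⟯` both restrict to powers of the Frobenius `y ↦ y^{#k}` (Mathlib `bijective_frobeniusAlgEquivOfAlgebraic_pow`).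
(`Gal(k̄/k) ≅ Ẑ` is abelian.) [cite: SerreLocalFields1979, Ch. I §8 (Galois theory of finite fields)] -/
theorem algEquiv_mul_comm_of_finite_of_isAlgebraic {k L : Type*} [Field k] [Finite k] [Field L] [Algebra k L]
    [Algebra.IsAlgebraic k L] (f g : L ≃ₐ[k] L) : f * g = g * f := by
  haveI := Fintype.ofFinite k
  apply AlgEquiv.ext
  intro x
  set E : IntermediateField k L := k⟮x⟯ with hE
  haveI : FiniteDimensional k E :=
    IntermediateField.adjoin.finiteDimensional (Algebra.IsIntegral.isIntegral (R := k) x)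
  haveI : Finite E := Module.finite_of_finite k
  have hx : x ∈ E := IntermediateField.mem_adjoin_simple_self k x
  obtain ⟨n, hn⟩ := (FiniteField.bijective_frobeniusAlgEquivOfAlgebraic_pow k E).2 (f.restrictNormal E)
  obtain ⟨m, hm⟩ := (FiniteField.bijective_frobeniusAlgEquivOfAlgebraic_pow k E).2 (g.restrictNormal E)
  have hc : f.restrictNormal E * g.restrictNormal E = g.restrictNormal E * f.restrictNormal E := by
    rw [← hn, ← hm]
    exact (Commute.pow_pow_self _ _ _).eq
  have key : ∀ (h : L ≃ₐ[k] L) (y : E), h (y : L) = ((h.restrictNormal E y : E) : L) :=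
    fun h y ↦ (AlgEquiv.restrictNormal_apply E h y).symm
  calc (f * g) x = f (g ((⟨x, hx⟩ : E) : L)) := rfl
    _ = (((f.restrictNormal E * g.restrictNormal E) ⟨x, hx⟩ : E) : L) := by
        rw [key g, key f, AlgEquiv.mul_apply]
    _ = (((g.restrictNormal E * f.restrictNormal E) ⟨x, hx⟩ : E) : L) := by rw [hc]
    _ = g (f ((⟨x, hx⟩ : E) : L)) := by rw [AlgEquiv.mul_apply, ← key g, ← key f]
    _ = (g * f) x := rfl

end FiniteField

/-! ### §2 Local fields: `[Γ_F, Γ_F] ⊆ I_F` -/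

section Local

open ValuativeRel Field Literature.NumberTheory.GaloisRepresentations
  Literature.NumberTheory.GaloisRepresentations.IsNonarchimedeanLocalField

variable (F : Type*) [Field F] [ValuativeRel F] [TopologicalSpace F] [IsNonarchimedeanLocalField F]

set_option maxHeartbeats 400000 in
/-- **`σ⁻¹ τ⁻¹ σ τ ∈ I_F` for all `σ, τ ∈ Γ_F`** (`F` a non-archimedean local field): the whole of `Γ_F` stabilises the canonical
prime `𝔓` of `\bar 𝒪_F` (`smul_absMaximalIdeal_holds`), the induced action on the residue extension `\bar 𝒪_F/𝔓 ⊇ 𝒪_F/𝓂_F`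
(Mathlib `Ideal.Quotient.stabilizerHom`) has kernel the inertia group (`ker_stabilizerHom`), and its target — the
`𝒪_F/𝓂_F`-automorphisms of an algebraic extension of the FINITE residue field — is commutative (§1). Serre: `D/I ≅ Gal(k̄/k)`.
[cite: SerreLocalFields1979, Ch. I §7 Prop. 20–21 and §8] -/
theorem commutator_mem_absInertia (σ τ : absoluteGaloisGroup F) : σ⁻¹ * τ⁻¹ * σ * τ ∈ absInertia F := by
  classical
  haveI hmax : (absMaximalIdeal F).IsMaximal := absMaximalIdeal_isMaximal_holds F
  haveI hfin : Finite (𝒪[F] ⧸ (absMaximalIdeal F).under 𝒪[F]) := by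
    rw [under_absMaximalIdeal_holds F]
    exact (inferInstance : Finite 𝓀[F])
  haveI hmax' : ((absMaximalIdeal F).under 𝒪[F]).IsMaximal := Ideal.IsMaximal.under 𝒪[F] (absMaximalIdeal F)
  letI : Field (𝒪[F] ⧸ (absMaximalIdeal F).under 𝒪[F]) := Ideal.Quotient.field _
  letI : Field (absIntegers 𝒪[F] F ⧸ absMaximalIdeal F) := Ideal.Quotient.field _
  haveI : Algebra.IsIntegral (𝒪[F] ⧸ (absMaximalIdeal F).under 𝒪[F]) (absIntegers 𝒪[F] F ⧸ absMaximalIdeal F) :=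
    Ideal.Quotient.algebra_isIntegral_of_liesOver _ _
  haveI : Algebra.IsAlgebraic (𝒪[F] ⧸ (absMaximalIdeal F).under 𝒪[F]) (absIntegers 𝒪[F] F ⧸ absMaximalIdeal F) :=
    Algebra.IsIntegral.isAlgebraic
  have hst : ∀ g : absoluteGaloisGroup F, g ∈ MulAction.stabilizer (absoluteGaloisGroup F) (absMaximalIdeal F) :=
    fun g ↦ smul_absMaximalIdeal_holds F g
  let f := Ideal.Quotient.stabilizerHom (absMaximalIdeal F) ((absMaximalIdeal F).under 𝒪[F]) (absoluteGaloisGroup F)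
  let s : MulAction.stabilizer (absoluteGaloisGroup F) (absMaximalIdeal F) := ⟨σ, hst σ⟩
  let t : MulAction.stabilizer (absoluteGaloisGroup F) (absMaximalIdeal F) := ⟨τ, hst τ⟩
  have hcomm : f s * f t = f t * f s := algEquiv_mul_comm_of_finite_of_isAlgebraic (f s) (f t)
  have hker : s⁻¹ * t⁻¹ * s * t ∈ f.ker := by
    rw [MonoidHom.mem_ker, map_mul, map_mul, map_mul, map_inv, map_inv,
      show (f s)⁻¹ * (f t)⁻¹ * f s * f t = (f s)⁻¹ * (f t)⁻¹ * (f s * f t) by group, hcomm]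
    group
  rw [Ideal.Quotient.ker_stabilizerHom] at hker
  intro x
  exact hker x

end Local

/-! ### §3 Number fields: `[D_v, D_v] ⊆ I_v` for the chosen embedding -/

section Global

open NumberField IsDedekindDomain Field Literature.NumberTheory.GaloisRepresentations
  Literature.NumberTheory.EllipticCurves.GreenbergSelmer

variable {K : Type} [Field K] [NumberField K]

/-- **`x⁻¹ y⁻¹ x y ∈ I_v` for `x, y ∈ D_v`** (`D_v`, `I_v` the decomposition / inertia groups of the chosen prime above the finite place
`v`, i.e. the images of `Γ_{K_v}`, `I_{K_v}` under `Γ_{K_v} → Γ_K`): §2 at the completion `K_v`, pushed forward.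
[cite: SerreLocalFields1979, Ch. I §7 Prop. 20–21 and §8] [cite: NeukirchANT1999, Ch. II §9 Prop. (9.6)] -/
theorem commutator_mem_inertia (v : HeightOneSpectrum (𝓞 K)) {x y : absoluteGaloisGroup K}
    (hx : x ∈ decomp v) (hy : y ∈ decomp v) : x⁻¹ * y⁻¹ * x * y ∈ inertia v := by
  obtain ⟨σ, rfl⟩ := (mem_decomp_iff v x).mp hx
  obtain ⟨τ, rfl⟩ := (mem_decomp_iff v y).mp hy
  refine Subgroup.mem_map.mpr ⟨σ⁻¹ * τ⁻¹ * σ * τ, commutator_mem_absInertia (v.adicCompletion K) σ τ, ?_⟩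
  simp only [map_mul, map_inv]
  rfl

end Global

/-! ### §4 The bridge, unconditionally -/

section Bridge

open NumberField IsDedekindDomain Field WeierstrassCurve
open Literature.NumberTheory.EllipticCurves Literature.NumberTheory.EllipticCurves.GreenbergSelmer
  Literature.NumberTheory.EllipticCurves.GreenbergVatsal2000 Literature.NumberTheory.GaloisRepresentations
  Literature.NumberTheory.EllipticCurves.KellerYin2024 Literature.NumberTheory.EllipticCurves.Rank1Residual
  Literature.NumberTheory.QuadraticFields

variable {K : Type} [Field K] [NumberField K] {p : ℕ} [hp : Fact p.Prime] (κ : ZpExtension K p)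
  (vbar : HeightOneSpectrum (𝓞 K)) (S₀ : Set (HeightOneSpectrum (𝓞 K)))
  (θ : FramedGaloisRep K (padicCoeffIntegers (∅ : Set (PadicAlgCl p))) 1)

/-- **`H¹_{𝓕_Gr^{S₀}}(K_∞, (F/𝒪)(θ)) = H¹_{𝓕_nr^{S₀}}(K_∞, (F/𝒪)(θ))` for a Teichmüller character `θ` with `D_v̄` NOT fixing `(F/𝒪)(θ)[p]`
pointwise («`θ|_{G_v̄} ≠ 𝟙`»)** — UNCONDITIONAL (any number field, any `ℤ_p`-extension `κ`, any `v̄`, any `S₀`): p660721's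
`grSelmer_charModule_eq_unrSelmer_of_not_forall_decomp` with its hypothesis `[D_v̄, D_v̄] ⊆ I_v̄` discharged by §3. CGLS, proof of Thm. 1.2.2:
«the Selmer group `H¹_{F_Gr}(K, M_θ)` is the same as the one defined by the unramified local conditions».
[cite: CastellaGrossiLeeSkinner2022, proof of Thm. 1.2.2 with Prop. 1.1.2 (i) (arXiv:2008.02571 Thm. 11)]
[cite: KellerYin2024, Rem. 1.2.3 (i), Lemma 1.2.4 (arXiv:2402.12781v2 TeX L685–800)] -/
theorem grSelmer_charModule_eq_unrSelmer (hθ : ∀ σ : absoluteGaloisGroup K, θ σ ^ (p - 1) = 1)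
    (hne1 : ¬ ∀ g ∈ decomp vbar, ∀ m : charModule (∅ : Set (PadicAlgCl p)) θ, p • m = 0 → g • m = m) :
    grSelmer κ (charModule (∅ : Set (PadicAlgCl p)) θ) vbar S₀ = unrSelmer κ (charModule (∅ : Set (PadicAlgCl p)) θ) vbar S₀ :=
  grSelmer_charModule_eq_unrSelmer_of_not_forall_decomp κ vbar S₀ θ hθ
    (fun _ hx _ hy ↦ commutator_mem_inertia vbar hx hy) hne1

/-- **At a NON-SPLIT multiplicative Eisenstein datum the strict and the unramified Selmer groups over `K_∞` of BOTH residual characters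
COINCIDE, for every `S₀`**: `W/ℚ` globally minimal, `2 < p`, `p ‖ N` non-split, `K` imaginary quadratic with the Heegner hypothesis for
`N_E`, `(p)` split, `v̄ ∋ p`, `κ` any `ℤ_p`-extension, `Sf` the places over `N_E` off `p`, `(θsub, θquot)` a residual pair of `E_K[p]`,
`θ ∈ {θsub, θquot}`: `grSelmer κ (charModule ∅ θ) v̄ S₀ = unrSelmer κ (charModule ∅ θ) v̄ S₀`. The character-level binder «`D_v̄` does not
fix `(F/𝒪)(θ)[p]` pointwise» is this seat's `CharGrSelmerLambdaRelaxation.charHypotheses_of_not_split` (Tate curve at a non-split `p`,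
g6's `localData_of_not_split`). Hence the crux-4 chain ([ALG-imp] + [PWL-θ], p654300/p658583/p659748, `GrDualData`) and the cell's
[BR] statements (`DatumDualData` of `unrSelmer`) concern the SAME groups. [cite: CastellaGrossiLeeSkinner2022, proof of Thm. 1.2.2]
[cite: KellerYin2024, Rem. 1.2.3, Lemma 1.2.4, Lemma 5.1.1 (arXiv:2402.12781v2)] [cite: SilvermanATAEC1994, Ch. V Thm. 5.3] -/
theorem grSelmer_eq_unrSelmer_of_not_split (W : WeierstrassCurve ℚ) [W.IsElliptic] [W.IsGloballyMinimal]
    (Sf : Finset (HeightOneSpectrum (𝓞 K)))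
    (hp2 : 2 < p) (hmult : Mult W p) (hns : ¬ W.HasSplitMultiplicativeReductionAtPrime p)
    (hK : IsImaginaryQuadratic K) (hH : SatisfiesHeegnerHypothesis (W.conductorNorm ℤ) K)
    (hsplit : ((Ideal.span {(p : ℤ)}).primesOver (𝓞 K)).ncard = 2)
    (hvbar : ((p : ℕ) : 𝓞 K) ∈ vbar.asIdeal)
    (hSf : ∀ w : HeightOneSpectrum (𝓞 K), w ∈ Sf ↔
      (((W.conductorNorm ℤ : ℤ) : 𝓞 K) ∈ w.asIdeal ∧ ((p : ℕ) : 𝓞 K) ∉ w.asIdeal))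
    (θsub θquot : FramedGaloisRep K (padicCoeffIntegers (∅ : Set (PadicAlgCl p))) 1)
    (hpair : IsResidualPairOver (W.baseChange K) p θsub θquot) (hθ : θ = θsub ∨ θ = θquot) :
    grSelmer κ (charModule (∅ : Set (PadicAlgCl p)) θ) vbar S₀ = unrSelmer κ (charModule (∅ : Set (PadicAlgCl p)) θ) vbar S₀ := by
  obtain ⟨-, hchar⟩ := CharGrSelmerLambdaRelaxation.charHypotheses_of_not_split W K vbar κ Sf hp2 hmult hns hK hH hsplit hvbar hSf
    θsub θquot hpair
  obtain ⟨hθT, -, hne1, -⟩ := hchar θ hθ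
  exact grSelmer_charModule_eq_unrSelmer κ vbar S₀ θ hθT hne1

end Bridge

end Summit.BirchSwinnertonDyer.BirchSwinnertonDyer.Theorems.StrictEqUnramifiedCentral

end
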